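import Summits.CriticalPhenomena.PercolationContinuityZ3.Theorems.PercNearOneGluingNoHeavyLowerTailKnQuestion8CoefficientwiseCoreClassKernelMixMergedScheme
import Summits.CriticalPhenomena.PercolationContinuityZ3.Theorems.PercNearOneGluingNoHeavyLowerTailKnQuestion8CoefficientwiseCoreClassKernelMixBundleFibreTransfer
import HarnessLib

/-!
# Boundary inequality on bundles, IX: the merged scheme in the kernel and the TWO-FREEZE THEOREM

Support file (`--supports stmt-CriticalPhenomena-4575`, closed), prover `prim-cplus-coupling` (gen 57).  No definitions, no notations, no named facts,
no sorries; standard axioms.  Memo `prim-cplus-coupling/A5-COUPLING-gen57.md` §2.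

SETTING.  An explicit bundle `Θ(ℓ₁..ℓ_r)` as in `…KernelMixBundleBoundary` (threads `t < r`, edges `e t j`, edge sets `A t`, `E = ⋃ A t`, `C ω = C_u(ω)`),
an up-closed event `𝒱`, monotone `{0,1}`-valued levels `hᵃ, hᵇ, kᵃ, kᵇ`; DEMAND `b ∈ C(E∖σ) ∖ C σ`, SUPPLY `b ∈ C λ ∖ C(E∖λ)`; statuses as in the memos
(`bad₁ = hro ∧ kbo`, `L₁ = hᵃX = kᵇX = 1, hᵇY = kᵃY = 0`, type 2 with `h ↔ k`).  NO slab, NO lift: colourings of the WHOLE edge set.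
* `Coefficientwise.bundle_merged_scheme_count` (MERGED-SCHEME LEMMA): for two named threads `p ≠ q`, each either free or prefix-frozen (a thread may
  be frozen only if every type-1 source of `𝒱` starts red on it), `#bad₁(𝒱) ≤ #M` where `M ⊆ L₁(𝒱) ∩ SUPPLY` consists of colourings that start red
  and are not full on every frozen thread (Harris per prefix fibre of the whole cube; the landing IS the target, so `M` is a set — no same-type excess).
* `Coefficientwise.bundle_two_freeze_count` (TWO-FREEZE THEOREM): if the two types can be given frozen threads covering ALL threads (equivalently:
  no thread carries non-red-starting sources of both types), then `#bad₁(𝒱) + #bad₂(𝒱) ≤ #(L₁ ∪ L₂)(𝒱)` — the two landing sets are disjoint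
  because a common landing would have no fully red thread.  With the layer cake (`…KernelMixIETLayerCake`) this is `IET(𝒱) ≥ 0` for all monotone
  levels on every bundle (any `r`) and every such `𝒱`; exact SAT cross-check on 12 bases incl. 4-thread ones (memo gen 57 §2, kit j227204).
[cite: KozmaNitzan2024, Questions 8–9 (§5.5 p. 36) (context); Harris 1960]
-/

namespace Summit.CriticalPhenomena.PercolationContinuityZ3.Theorems

open Finset Literature.Probability.Percolation

namespace Coefficientwise

variable {ι V : Type*}

open Classical in
/-- **Merged-scheme lemma (one type, whole cube, no lift).**  On an explicit bundle with named threads `p ≠ q`, fibre flags `SP ∈ {{0}, [1, L p − 1]}`,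
`SQ` likewise (frozen only if all type-1 sources of `𝒱` start red there): `#{σ ⊆ E : 𝒱, demand, hro, kbo} ≤ #{λ ⊆ E : 𝒱, supply, L₁, red-starting
and not full on the frozen threads}`.  Memo gen 57 §2.  [cite: KozmaNitzan2024, Questions 8–9 (§5.5 p. 36) (context); Harris 1960] -/
theorem bundle_merged_scheme_count (ends : ι → Sym2 V) (r : ℕ) (L : ℕ → ℕ) (hL : ∀ t, t < r → 1 ≤ L t)
    (w : ℕ → ℕ → V) (e : ℕ → ℕ → ι) (u b : V)
    (hw0 : ∀ t, t < r → w t 0 = u) (hwL : ∀ t, t < r → w t (L t) = b)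
    (harc : ∀ t, t < r → ∀ j, 1 ≤ j → j ≤ L t → ends (e t j) = s(w t (j - 1), w t j))
    (hwinj : ∀ t, t < r → ∀ i j, i ≤ L t → j ≤ L t → w t i = w t j → i = j)
    (hcross : ∀ t t', t < r → t' < r → t ≠ t' → ∀ i j, i ≤ L t → j ≤ L t' → w t i = w t' j → (i = 0 ∧ j = 0) ∨ (i = L t ∧ j = L t'))
    (A : ℕ → Finset ι) (hA : ∀ t, t < r → ∀ i, i ∈ A t ↔ ∃ j, 1 ≤ j ∧ j ≤ L t ∧ e t j = i)
    (hAdisj : ∀ t t', t < r → t' < r → t ≠ t' → Disjoint (A t) (A t'))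
    (E : Finset ι) (hEA : ∀ i, i ∈ E ↔ ∃ t, t < r ∧ i ∈ A t)
    (p q : ℕ) (hp : p < r) (hq : q < r) (hpq : p ≠ q)
    (𝒱 : Finset ι → Prop) (hV : ∀ ⦃s t : Finset ι⦄, s ⊆ t → 𝒱 s → 𝒱 t)
    (ha hb ka kb : Set V → ℝ) (mha : Monotone ha) (mhb : Monotone hb) (mka : Monotone ka) (mkb : Monotone kb)
    (ha01 : ∀ S, ha S = 0 ∨ ha S = 1) (hb01 : ∀ S, hb S = 0 ∨ hb S = 1) (ka01 : ∀ S, ka S = 0 ∨ ka S = 1) (kb01 : ∀ S, kb S = 0 ∨ kb S = 1)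
    (SP SQ : Finset ℕ) (hSP : SP = {0} ∨ SP = Finset.Icc 1 (L p - 1)) (hSQ : SQ = {0} ∨ SQ = Finset.Icc 1 (L q - 1))
    (covP : SP = Finset.Icc 1 (L p - 1) → ∀ σ, σ ⊆ E →
      (𝒱 σ ∧ (b ∈ openCluster (ends '' (↑(E \ σ) : Set ι)) u ∧ b ∉ openCluster (ends '' (↑σ : Set ι)) u) ∧
        (ha (openCluster (ends '' (↑σ : Set ι)) u) = 1 ∧ hb (openCluster (ends '' (↑(E \ σ) : Set ι)) u) = 0) ∧
        (kb (openCluster (ends '' (↑(E \ σ) : Set ι)) u) = 1 ∧ ka (openCluster (ends '' (↑σ : Set ι)) u) = 0)) → e p 1 ∈ σ)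
    (covQ : SQ = Finset.Icc 1 (L q - 1) → ∀ σ, σ ⊆ E →
      (𝒱 σ ∧ (b ∈ openCluster (ends '' (↑(E \ σ) : Set ι)) u ∧ b ∉ openCluster (ends '' (↑σ : Set ι)) u) ∧
        (ha (openCluster (ends '' (↑σ : Set ι)) u) = 1 ∧ hb (openCluster (ends '' (↑(E \ σ) : Set ι)) u) = 0) ∧
        (kb (openCluster (ends '' (↑(E \ σ) : Set ι)) u) = 1 ∧ ka (openCluster (ends '' (↑σ : Set ι)) u) = 0)) → e q 1 ∈ σ) :
    ((E.powerset).filter (fun σ => 𝒱 σ ∧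
        (b ∈ openCluster (ends '' (↑(E \ σ) : Set ι)) u ∧ b ∉ openCluster (ends '' (↑σ : Set ι)) u) ∧
        (ha (openCluster (ends '' (↑σ : Set ι)) u) = 1 ∧ hb (openCluster (ends '' (↑(E \ σ) : Set ι)) u) = 0) ∧
        (kb (openCluster (ends '' (↑(E \ σ) : Set ι)) u) = 1 ∧ ka (openCluster (ends '' (↑σ : Set ι)) u) = 0))).card
    ≤ ((E.powerset).filter (fun lam => 𝒱 lam ∧
        (b ∈ openCluster (ends '' (↑lam : Set ι)) u ∧ b ∉ openCluster (ends '' (↑(E \ lam) : Set ι)) u) ∧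
        (ha (openCluster (ends '' (↑lam : Set ι)) u) = 1 ∧ kb (openCluster (ends '' (↑lam : Set ι)) u) = 1 ∧
          hb (openCluster (ends '' (↑(E \ lam) : Set ι)) u) = 0 ∧ ka (openCluster (ends '' (↑(E \ lam) : Set ι)) u) = 0) ∧
        (SP = Finset.Icc 1 (L p - 1) → e p 1 ∈ lam ∧ ¬ A p ⊆ lam) ∧ (SQ = Finset.Icc 1 (L q - 1) → e q 1 ∈ lam ∧ ¬ A q ⊆ lam))).card := by
  set C : Finset ι → Set V := fun ω => openCluster (ends '' (↑ω : Set ι)) u with hC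
  -- ## bundle bookkeeping
  have hr : 0 < r := lt_of_le_of_lt (Nat.zero_le p) hp
  have hAE : ∀ t, t < r → A t ⊆ E := fun t ht i hi => (hEA i).mpr ⟨t, ht, hi⟩
  have heA : ∀ t, t < r → ∀ j, 1 ≤ j → j ≤ L t → e t j ∈ A t := fun t ht j hj1 hjL => (hA t ht _).mpr ⟨j, hj1, hjL, rfl⟩
  have full_iff : ∀ ω : Finset ι, ω ⊆ E → (b ∈ C ω ↔ ∃ t, t < r ∧ A t ⊆ ω) := fun ω hω =>
    bundle_b_mem_cluster_iff_threads ends r L hL w e u b hr hw0 hwL harc hwinj hcross A hA E hEA ω hω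
  have einj : ∀ t, t < r → ∀ i j, 1 ≤ i → i ≤ L t → 1 ≤ j → j ≤ L t → e t i = e t j → i = j := by
    intro t ht i j hi1 hiL hj1 hjL hij
    have h := harc t ht i hi1 hiL
    rw [hij, harc t ht j hj1 hjL] at h
    rcases Sym2.eq_iff.mp h with ⟨h1, _⟩ | ⟨h1, h2⟩
    · have := hwinj t ht (j - 1) (i - 1) (by omega) (by omega) h1; omega
    · have e1 := hwinj t ht (j - 1) i (by omega) hiL h1
      have e2 := hwinj t ht j (i - 1) hjL (by omega) h2
      omega
  -- 0/1 bookkeeping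
  have one_of_ge : ∀ (f : Set V → ℝ), (∀ S, f S = 0 ∨ f S = 1) → ∀ S S' : Set V, S ⊆ S' → Monotone f → f S = 1 → f S' = 1 := by
    intro f f01 S S' hSS' mf h1
    rcases f01 S' with h0 | h0
    · have := mf hSS'; rw [h1, h0] at this; linarith
    · exact h0
  have zero_of_le : ∀ (f : Set V → ℝ), (∀ S, f S = 0 ∨ f S = 1) → ∀ S S' : Set V, S ⊆ S' → Monotone f → f S' = 0 → f S = 0 := by
    intro f f01 S S' hSS' mf h0
    rcases f01 S with h1 | h1
    · exact h1
    · have := mf hSS'; rw [h1, h0] at this; linarith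
  have Cmono : ∀ s t : Finset ι, s ⊆ t → C s ⊆ C t := fun s t hst => openCluster_image_mono ends hst u
  have Ccompl : ∀ s t : Finset ι, s ⊆ t → C (E \ t) ⊆ C (E \ s) := fun s t hst => Cmono _ _ (Finset.sdiff_subset_sdiff (le_refl E) hst)
  -- ## statuses and demand are monotone
  have hro_mono : ∀ s t : Finset ι, s ⊆ t → (ha (C s) = 1 ∧ hb (C (E \ s)) = 0) → (ha (C t) = 1 ∧ hb (C (E \ t)) = 0) := by
    intro s t hst hs
    exact ⟨one_of_ge ha ha01 _ _ (Cmono s t hst) mha hs.1, zero_of_le hb hb01 _ _ (Ccompl s t hst) mhb hs.2⟩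
  have kbo_anti : ∀ s t : Finset ι, s ⊆ t → (kb (C (E \ t)) = 1 ∧ ka (C t) = 0) → (kb (C (E \ s)) = 1 ∧ ka (C s) = 0) := by
    intro s t hst ht
    exact ⟨one_of_ge kb kb01 _ _ (Ccompl s t hst) mkb ht.1, zero_of_le ka ka01 _ _ (Cmono s t hst) mka ht.2⟩
  have N_anti : ∀ s t : Finset ι, s ⊆ t → (b ∈ C (E \ t) ∧ b ∉ C t) → (b ∈ C (E \ s) ∧ b ∉ C s) := by
    intro s t hst ht
    exact ⟨Ccompl s t hst ht.1, fun hm => ht.2 (Cmono s t hst hm)⟩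
  have hNPQ : ∀ σ, σ ⊆ E → (b ∈ C (E \ σ) ∧ b ∉ C σ) → ¬ A p ⊆ σ ∧ ¬ A q ⊆ σ := by
    intro σ hσ hN
    exact ⟨fun hsub => hN.2 ((full_iff σ hσ).mpr ⟨p, hp, hsub⟩), fun hsub => hN.2 ((full_iff σ hσ).mpr ⟨q, hq, hsub⟩)⟩
  -- ## transfer: a landing is an L₁-supply point of 𝒱, red-starting and not full on the frozen threads
  have transfer : ∀ a c : ℕ, a ∈ SP → c ∈ SQ → a < L p → c < L q → ∀ ξ ρ : Finset ι, ξ ⊆ E → ρ ⊆ E →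
      (∀ j, 1 ≤ j → j ≤ a → e p j ∈ ξ ∧ e p j ∈ ρ) → (1 ≤ a → e p (a + 1) ∉ ξ ∧ e p (a + 1) ∉ ρ) →
      (∀ j, 1 ≤ j → j ≤ L p → (a = 0 ∨ a + 2 ≤ j) → (e p j ∈ ρ ↔ e p j ∉ ξ)) →
      (∀ j, 1 ≤ j → j ≤ c → e q j ∈ ξ ∧ e q j ∈ ρ) → (1 ≤ c → e q (c + 1) ∉ ξ ∧ e q (c + 1) ∉ ρ) →
      (∀ j, 1 ≤ j → j ≤ L q → (c = 0 ∨ c + 2 ≤ j) → (e q j ∈ ρ ↔ e q j ∉ ξ)) →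
      (∀ x, x ∈ E → x ∉ A p → x ∉ A q → (x ∈ ρ ↔ x ∉ ξ)) →
      𝒱 ξ → (ha (C ξ) = 1 ∧ hb (C (E \ ξ)) = 0) → (kb (C (E \ ρ)) = 1 ∧ ka (C ρ) = 0) → (b ∈ C (E \ ρ) ∧ b ∉ C ρ) →
      (𝒱 ξ ∧ (b ∈ C ξ ∧ b ∉ C (E \ ξ)) ∧ (ha (C ξ) = 1 ∧ kb (C ξ) = 1 ∧ hb (C (E \ ξ)) = 0 ∧ ka (C (E \ ξ)) = 0) ∧
        (SP = Finset.Icc 1 (L p - 1) → e p 1 ∈ ξ ∧ ¬ A p ⊆ ξ) ∧ (SQ = Finset.Icc 1 (L q - 1) → e q 1 ∈ ξ ∧ ¬ A q ⊆ ξ)) := by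
    intro a c haS hcS haL hcL ξ ρ hξ hρ hPa hPa1 hPfree hQc hQc1 hQfree hrest hv hh hk hN
    -- kinds: every thread PREFIX/FREE (κ = 2), lengths a on p, c on q, 0 elsewhere; no lift (lam = ξ)
    obtain ⟨κ, hκ⟩ : ∃ f : ℕ → ℕ, f = fun _ => 2 := ⟨_, rfl⟩
    obtain ⟨al, hal⟩ : ∃ f : ℕ → ℕ, f = fun t => if t = p then a else if t = q then c else 0 := ⟨_, rfl⟩
    have halp : al p = a := by rw [hal]; simp
    have halq : al q = c := by rw [hal]; simp [hpq.symm]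
    have halo : ∀ t, t ≠ p → t ≠ q → al t = 0 := by intro t htp htq; rw [hal]; simp [htp, htq]
    have hnf : ∀ t, t < r → ∃ j, 1 ≤ j ∧ j ≤ L t ∧ e t j ∉ ρ := by
      intro t ht
      by_contra hno
      push Not at hno
      exact hN.2 ((full_iff ρ hρ).mpr ⟨t, ht, fun x hx => by
        obtain ⟨j, hj1, hjL, rfl⟩ := (hA t ht x).mp hx
        exact hno j hj1 hjL⟩)
    have hempty : ∃ t, t < r ∧ ∀ j, 1 ≤ j → j ≤ L t → e t j ∉ ρ := by
      obtain ⟨t, ht, hsub⟩ := (full_iff (E \ ρ) Finset.sdiff_subset).mp hN.1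
      exact ⟨t, ht, fun j hj1 hjL => (Finset.mem_sdiff.mp (hsub (heA t ht j hj1 hjL))).2⟩
    have key := bundle_fibre_transfer ends r L hL w e u b hw0 hwL harc hwinj hcross A hA E hEA κ al ξ ρ ξ hξ
      (fun t ht j hj1 hjL => by rw [hκ]; simp)
      (fun t ht h1 => by rw [hκ] at h1; exact absurd h1 (by norm_num))
      (fun t ht _ => by
        by_cases htp : t = p
        · subst htp; rw [halp]; exact ⟨haL, hPa, hPa1, hPfree⟩
        by_cases htq : t = q
        · subst htq; rw [halq]; exact ⟨hcL, hQc, hQc1, hQfree⟩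
        rw [halo t htp htq]
        refine ⟨Nat.lt_of_lt_of_le Nat.zero_lt_one (hL t ht), fun j hj1 hj0 => by omega, fun h => by omega, fun j hj1 hjL _ => ?_⟩
        have hx : e t j ∈ E := hAE t ht (heA t ht j hj1 hjL)
        exact hrest (e t j) hx (fun hm => Finset.disjoint_left.mp (hAdisj t p ht hp htp) (heA t ht j hj1 hjL) hm)
          (fun hm => Finset.disjoint_left.mp (hAdisj t q ht hq htq) (heA t ht j hj1 hjL) hm))
      (fun t ht => by rw [hκ]; exact Or.inr (Or.inr rfl)) hnf hempty
    obtain ⟨hbX, hbY, T2, T3⟩ := key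
    refine ⟨hv, ⟨hbX, hbY⟩, ⟨hh.1, one_of_ge kb kb01 _ _ T2 mkb hk.1, hh.2, zero_of_le ka ka01 _ _ T3 mka hk.2⟩, ?_, ?_⟩
    · intro hS
      have ha1 : 1 ≤ a := by rw [hS, Finset.mem_Icc] at haS; exact haS.1
      exact ⟨(hPa 1 (le_refl 1) ha1).1, fun hsub => (hPa1 ha1).1 (hsub (heA p hp (a + 1) (by omega) (by omega)))⟩
    · intro hS
      have hc1 : 1 ≤ c := by rw [hS, Finset.mem_Icc] at hcS; exact hcS.1
      exact ⟨(hQc 1 (le_refl 1) hc1).1, fun hsub => (hQc1 hc1).1 (hsub (heA q hq (c + 1) (by omega) (by omega)))⟩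
  -- ## the abstract theorem
  have key := fibre_system_count E (A p) (A q) (hAE p hp) (hAE q hq) (hAdisj p q hp hq hpq) (L p) (L q) (hL p hp) (hL q hq) (e p) (e q)
    (heA p hp) (einj p hp) (fun x hx => (hA p hp x).mp hx) (heA q hq) (einj q hq) (fun x hx => (hA q hq x).mp hx)
    𝒱 (fun ξ => ha (C ξ) = 1 ∧ hb (C (E \ ξ)) = 0) (fun ξ => kb (C (E \ ξ)) = 1 ∧ ka (C ξ) = 0)
    (fun ξ => b ∈ C (E \ ξ) ∧ b ∉ C ξ)
    (fun lam => 𝒱 lam ∧ (b ∈ C lam ∧ b ∉ C (E \ lam)) ∧ (ha (C lam) = 1 ∧ kb (C lam) = 1 ∧ hb (C (E \ lam)) = 0 ∧ ka (C (E \ lam)) = 0) ∧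
      (SP = Finset.Icc 1 (L p - 1) → e p 1 ∈ lam ∧ ¬ A p ⊆ lam) ∧ (SQ = Finset.Icc 1 (L q - 1) → e q 1 ∈ lam ∧ ¬ A q ⊆ lam))
    (fun s t hst hs => hV hst hs) hro_mono kbo_anti N_anti hNPQ SP SQ hSP hSQ covP covQ transfer
  convert key using 3

open Classical in
/-- **TWO-FREEZE THEOREM (all 0/1 levels, every bundle).**  On an explicit bundle let type 1 be given named threads `p₁ ≠ q₁` with fibre flags
`SP₁, SQ₁` and type 2 named threads `p₂ ≠ q₂` with flags `SP₂, SQ₂` (a thread frozen for a type only if every source of that type in `𝒱` starts red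
on it), such that EVERY thread `t < r` is frozen for at least one type.  Then `#bad₁(𝒱) + #bad₂(𝒱) ≤ #(L₁ ∪ L₂)(𝒱)` (demand points vs supply points of
the whole cube; no joins needed).  Equivalently: if no thread carries non-red-starting sources of both types, `IET(𝒱) ≥ 0`.  Memo gen 57 §2.
[cite: KozmaNitzan2024, Questions 8–9 (§5.5 p. 36) (context); Harris 1960] -/
theorem bundle_two_freeze_count (ends : ι → Sym2 V) (r : ℕ) (L : ℕ → ℕ) (hL : ∀ t, t < r → 1 ≤ L t)
    (w : ℕ → ℕ → V) (e : ℕ → ℕ → ι) (u b : V)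
    (hw0 : ∀ t, t < r → w t 0 = u) (hwL : ∀ t, t < r → w t (L t) = b)
    (harc : ∀ t, t < r → ∀ j, 1 ≤ j → j ≤ L t → ends (e t j) = s(w t (j - 1), w t j))
    (hwinj : ∀ t, t < r → ∀ i j, i ≤ L t → j ≤ L t → w t i = w t j → i = j)
    (hcross : ∀ t t', t < r → t' < r → t ≠ t' → ∀ i j, i ≤ L t → j ≤ L t' → w t i = w t' j → (i = 0 ∧ j = 0) ∨ (i = L t ∧ j = L t'))
    (A : ℕ → Finset ι) (hA : ∀ t, t < r → ∀ i, i ∈ A t ↔ ∃ j, 1 ≤ j ∧ j ≤ L t ∧ e t j = i)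
    (hAdisj : ∀ t t', t < r → t' < r → t ≠ t' → Disjoint (A t) (A t'))
    (E : Finset ι) (hEA : ∀ i, i ∈ E ↔ ∃ t, t < r ∧ i ∈ A t)
    (p₁ q₁ : ℕ) (hp₁ : p₁ < r) (hq₁ : q₁ < r) (hpq₁ : p₁ ≠ q₁) (p₂ q₂ : ℕ) (hp₂ : p₂ < r) (hq₂ : q₂ < r) (hpq₂ : p₂ ≠ q₂)
    (𝒱 : Finset ι → Prop) (hV : ∀ ⦃s t : Finset ι⦄, s ⊆ t → 𝒱 s → 𝒱 t)
    (ha hb ka kb : Set V → ℝ) (mha : Monotone ha) (mhb : Monotone hb) (mka : Monotone ka) (mkb : Monotone kb)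
    (ha01 : ∀ S, ha S = 0 ∨ ha S = 1) (hb01 : ∀ S, hb S = 0 ∨ hb S = 1) (ka01 : ∀ S, ka S = 0 ∨ ka S = 1) (kb01 : ∀ S, kb S = 0 ∨ kb S = 1)
    (SP₁ SQ₁ SP₂ SQ₂ : Finset ℕ)
    (hSP₁ : SP₁ = {0} ∨ SP₁ = Finset.Icc 1 (L p₁ - 1)) (hSQ₁ : SQ₁ = {0} ∨ SQ₁ = Finset.Icc 1 (L q₁ - 1))
    (hSP₂ : SP₂ = {0} ∨ SP₂ = Finset.Icc 1 (L p₂ - 1)) (hSQ₂ : SQ₂ = {0} ∨ SQ₂ = Finset.Icc 1 (L q₂ - 1))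
    (cov₁P : SP₁ = Finset.Icc 1 (L p₁ - 1) → ∀ σ, σ ⊆ E →
      (𝒱 σ ∧ (b ∈ openCluster (ends '' (↑(E \ σ) : Set ι)) u ∧ b ∉ openCluster (ends '' (↑σ : Set ι)) u) ∧
        (ha (openCluster (ends '' (↑σ : Set ι)) u) = 1 ∧ hb (openCluster (ends '' (↑(E \ σ) : Set ι)) u) = 0) ∧
        (kb (openCluster (ends '' (↑(E \ σ) : Set ι)) u) = 1 ∧ ka (openCluster (ends '' (↑σ : Set ι)) u) = 0)) → e p₁ 1 ∈ σ)
    (cov₁Q : SQ₁ = Finset.Icc 1 (L q₁ - 1) → ∀ σ, σ ⊆ E →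
      (𝒱 σ ∧ (b ∈ openCluster (ends '' (↑(E \ σ) : Set ι)) u ∧ b ∉ openCluster (ends '' (↑σ : Set ι)) u) ∧
        (ha (openCluster (ends '' (↑σ : Set ι)) u) = 1 ∧ hb (openCluster (ends '' (↑(E \ σ) : Set ι)) u) = 0) ∧
        (kb (openCluster (ends '' (↑(E \ σ) : Set ι)) u) = 1 ∧ ka (openCluster (ends '' (↑σ : Set ι)) u) = 0)) → e q₁ 1 ∈ σ)
    (cov₂P : SP₂ = Finset.Icc 1 (L p₂ - 1) → ∀ σ, σ ⊆ E →
      (𝒱 σ ∧ (b ∈ openCluster (ends '' (↑(E \ σ) : Set ι)) u ∧ b ∉ openCluster (ends '' (↑σ : Set ι)) u) ∧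
        (ka (openCluster (ends '' (↑σ : Set ι)) u) = 1 ∧ kb (openCluster (ends '' (↑(E \ σ) : Set ι)) u) = 0) ∧
        (hb (openCluster (ends '' (↑(E \ σ) : Set ι)) u) = 1 ∧ ha (openCluster (ends '' (↑σ : Set ι)) u) = 0)) → e p₂ 1 ∈ σ)
    (cov₂Q : SQ₂ = Finset.Icc 1 (L q₂ - 1) → ∀ σ, σ ⊆ E →
      (𝒱 σ ∧ (b ∈ openCluster (ends '' (↑(E \ σ) : Set ι)) u ∧ b ∉ openCluster (ends '' (↑σ : Set ι)) u) ∧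
        (ka (openCluster (ends '' (↑σ : Set ι)) u) = 1 ∧ kb (openCluster (ends '' (↑(E \ σ) : Set ι)) u) = 0) ∧
        (hb (openCluster (ends '' (↑(E \ σ) : Set ι)) u) = 1 ∧ ha (openCluster (ends '' (↑σ : Set ι)) u) = 0)) → e q₂ 1 ∈ σ)
    (hall : ∀ t, t < r → (t = p₁ ∧ SP₁ = Finset.Icc 1 (L p₁ - 1)) ∨ (t = q₁ ∧ SQ₁ = Finset.Icc 1 (L q₁ - 1)) ∨
      (t = p₂ ∧ SP₂ = Finset.Icc 1 (L p₂ - 1)) ∨ (t = q₂ ∧ SQ₂ = Finset.Icc 1 (L q₂ - 1))) :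
    ((E.powerset).filter (fun σ => 𝒱 σ ∧
        (b ∈ openCluster (ends '' (↑(E \ σ) : Set ι)) u ∧ b ∉ openCluster (ends '' (↑σ : Set ι)) u) ∧
        (ha (openCluster (ends '' (↑σ : Set ι)) u) = 1 ∧ hb (openCluster (ends '' (↑(E \ σ) : Set ι)) u) = 0) ∧
        (kb (openCluster (ends '' (↑(E \ σ) : Set ι)) u) = 1 ∧ ka (openCluster (ends '' (↑σ : Set ι)) u) = 0))).card
    + ((E.powerset).filter (fun σ => 𝒱 σ ∧
        (b ∈ openCluster (ends '' (↑(E \ σ) : Set ι)) u ∧ b ∉ openCluster (ends '' (↑σ : Set ι)) u) ∧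
        (ka (openCluster (ends '' (↑σ : Set ι)) u) = 1 ∧ kb (openCluster (ends '' (↑(E \ σ) : Set ι)) u) = 0) ∧
        (hb (openCluster (ends '' (↑(E \ σ) : Set ι)) u) = 1 ∧ ha (openCluster (ends '' (↑σ : Set ι)) u) = 0))).card
    ≤ ((E.powerset).filter (fun lam => 𝒱 lam ∧
        (b ∈ openCluster (ends '' (↑lam : Set ι)) u ∧ b ∉ openCluster (ends '' (↑(E \ lam) : Set ι)) u) ∧
        ((ha (openCluster (ends '' (↑lam : Set ι)) u) = 1 ∧ kb (openCluster (ends '' (↑lam : Set ι)) u) = 1 ∧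
            hb (openCluster (ends '' (↑(E \ lam) : Set ι)) u) = 0 ∧ ka (openCluster (ends '' (↑(E \ lam) : Set ι)) u) = 0) ∨
          (ka (openCluster (ends '' (↑lam : Set ι)) u) = 1 ∧ hb (openCluster (ends '' (↑lam : Set ι)) u) = 1 ∧
            kb (openCluster (ends '' (↑(E \ lam) : Set ι)) u) = 0 ∧ ha (openCluster (ends '' (↑(E \ lam) : Set ι)) u) = 0)))).card := by
  set C : Finset ι → Set V := fun ω => openCluster (ends '' (↑ω : Set ι)) u with hC
  have hr : 0 < r := lt_of_le_of_lt (Nat.zero_le p₁) hp₁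
  have full_iff : ∀ ω : Finset ι, ω ⊆ E → (b ∈ C ω ↔ ∃ t, t < r ∧ A t ⊆ ω) := fun ω hω =>
    bundle_b_mem_cluster_iff_threads ends r L hL w e u b hr hw0 hwL harc hwinj hcross A hA E hEA ω hω
  -- the two merged schemes
  have k₁ := bundle_merged_scheme_count ends r L hL w e u b hw0 hwL harc hwinj hcross A hA hAdisj E hEA p₁ q₁ hp₁ hq₁ hpq₁ 𝒱 hV
    ha hb ka kb mha mhb mka mkb ha01 hb01 ka01 kb01 SP₁ SQ₁ hSP₁ hSQ₁ cov₁P cov₁Q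
  have k₂ := bundle_merged_scheme_count ends r L hL w e u b hw0 hwL harc hwinj hcross A hA hAdisj E hEA p₂ q₂ hp₂ hq₂ hpq₂ 𝒱 hV
    ka kb ha hb mka mkb mha mhb ka01 kb01 ha01 hb01 SP₂ SQ₂ hSP₂ hSQ₂ cov₂P cov₂Q
  set M₁ : Finset (Finset ι) := (E.powerset).filter (fun lam => 𝒱 lam ∧
        (b ∈ C lam ∧ b ∉ C (E \ lam)) ∧ (ha (C lam) = 1 ∧ kb (C lam) = 1 ∧ hb (C (E \ lam)) = 0 ∧ ka (C (E \ lam)) = 0) ∧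
        (SP₁ = Finset.Icc 1 (L p₁ - 1) → e p₁ 1 ∈ lam ∧ ¬ A p₁ ⊆ lam) ∧ (SQ₁ = Finset.Icc 1 (L q₁ - 1) → e q₁ 1 ∈ lam ∧ ¬ A q₁ ⊆ lam)) with hM₁
  set M₂ : Finset (Finset ι) := (E.powerset).filter (fun lam => 𝒱 lam ∧
        (b ∈ C lam ∧ b ∉ C (E \ lam)) ∧ (ka (C lam) = 1 ∧ hb (C lam) = 1 ∧ kb (C (E \ lam)) = 0 ∧ ha (C (E \ lam)) = 0) ∧
        (SP₂ = Finset.Icc 1 (L p₂ - 1) → e p₂ 1 ∈ lam ∧ ¬ A p₂ ⊆ lam) ∧ (SQ₂ = Finset.Icc 1 (L q₂ - 1) → e q₂ 1 ∈ lam ∧ ¬ A q₂ ⊆ lam)) with hM₂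
  -- a common landing would have no fully red thread
  have hdisj : Disjoint M₁ M₂ := by
    rw [Finset.disjoint_left]
    intro lam h1 h2
    rw [hM₁, Finset.mem_filter, Finset.mem_powerset] at h1
    rw [hM₂, Finset.mem_filter, Finset.mem_powerset] at h2
    obtain ⟨hlamE, -, ⟨hbX, -⟩, -, f1P, f1Q⟩ := h1
    obtain ⟨-, -, -, -, f2P, f2Q⟩ := h2
    obtain ⟨t, ht, hsub⟩ := (full_iff lam hlamE).mp hbX
    rcases hall t ht with ⟨rfl, hS⟩ | ⟨rfl, hS⟩ | ⟨rfl, hS⟩ | ⟨rfl, hS⟩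
    · exact (f1P hS).2 hsub
    · exact (f1Q hS).2 hsub
    · exact (f2P hS).2 hsub
    · exact (f2Q hS).2 hsub
  -- landings are targets
  have hsub : M₁ ∪ M₂ ⊆ (E.powerset).filter (fun lam => 𝒱 lam ∧ (b ∈ C lam ∧ b ∉ C (E \ lam)) ∧
      ((ha (C lam) = 1 ∧ kb (C lam) = 1 ∧ hb (C (E \ lam)) = 0 ∧ ka (C (E \ lam)) = 0) ∨
        (ka (C lam) = 1 ∧ hb (C lam) = 1 ∧ kb (C (E \ lam)) = 0 ∧ ha (C (E \ lam)) = 0))) := by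
    intro lam hlam
    rcases Finset.mem_union.mp hlam with h | h
    · rw [hM₁, Finset.mem_filter] at h
      exact Finset.mem_filter.mpr ⟨h.1, h.2.1, h.2.2.1, Or.inl h.2.2.2.1⟩
    · rw [hM₂, Finset.mem_filter] at h
      exact Finset.mem_filter.mpr ⟨h.1, h.2.1, h.2.2.1, Or.inr h.2.2.2.1⟩
  have e1 := Finset.card_union_of_disjoint hdisj
  have c1 := Finset.card_le_card hsub
  have b₁ : ((E.powerset).filter (fun σ => 𝒱 σ ∧ (b ∈ C (E \ σ) ∧ b ∉ C σ) ∧ (ha (C σ) = 1 ∧ hb (C (E \ σ)) = 0) ∧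
      (kb (C (E \ σ)) = 1 ∧ ka (C σ) = 0))).card ≤ M₁.card := by convert k₁ using 3
  have b₂ : ((E.powerset).filter (fun σ => 𝒱 σ ∧ (b ∈ C (E \ σ) ∧ b ∉ C σ) ∧ (ka (C σ) = 1 ∧ kb (C (E \ σ)) = 0) ∧
      (hb (C (E \ σ)) = 1 ∧ ha (C σ) = 0))).card ≤ M₂.card := by convert k₂ using 3
  calc _ ≤ M₁.card + M₂.card := Nat.add_le_add b₁ b₂
    _ = (M₁ ∪ M₂).card := e1.symm
    _ ≤ _ := c1

end Coefficientwise

end Summit.CriticalPhenomena.PercolationContinuityZ3.Theorems
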